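import Literature.Computability.MetaComplexity.RefutationCNFUpperSteps
import Literature.Computability.MetaComplexity.RefutationCNFHardness
import HarnessLib

/-!
# Pudlák's refutation of `RREF(F,s)`: assembly and the length bound `O((snm)²)`

We complete the proof of the upper bound [Atserias–Müller 2020, Lemma 11]: for a satisfiable
CNF `F` with `n ≥ 1` variables and `m ≥ 1` clauses and `s ≥ 1` lines, `RREF(F,s)` has a
Resolution refutation of length `O((snm)²)`.

* `RefCNF.Pudlak.stepList_refutation` — the whole list `refutation α n m t` of
  `RefutationCNFUpperDefs.lean` is a step list over the axioms of `RREF(F, t+1)` (blocks of the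
  lines `0, …, t` by `stepList_lineBlock`, each providing `True(u)` for the later ones, then the
  final block);
* `RefCNF.Pudlak.length_refutation_le` — it has at most `17 · (snm)²` clauses;
* `StepList.image`, `RefCNF.clauseSet_toNat` — transport of step lists along the injective
  renaming `RefVar.code` of the variables into `ℕ`;
* `RefCNF.Pudlak.minResRefutationSize_rrefCNF_le` — hence
  `minResRefutationSize (rrefCNF F s) ≤ 68 · (snm)²` (four lines per step,
  `StepList.minResRefutationSize_le`).

* `rrefCNF_upperBound_holds` — the discharge of the named fact `rrefCNF_upperBound` of
  `RefutationCNF.lean` (constant `c = 68`), and `rrefGadget_hardness_of_lowerBound` — [AM20, Thm 2]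
  for the gadget (`rrefGadget_hardness`) conditional on the lower bound [AM20, Lemma 10]
  (`rrefCNF_lowerBound`) alone, via the §6 derivation of `RefutationCNFHardness.lean`. (They live
  here, in a file importing `RefutationCNF.lean`, rather than in the sibling `RefutationCNFProofs.lean`,
  which other proof developments extend concurrently.)

## References

* A. Atserias, M. Müller, *Automating Resolution is NP-hard*, J. ACM 67(5) (2020), Art. 31;
  arXiv:1904.02991, §5, Lemma 11 ("In fact, p(s,n,m) ∈ O((snm)²)").
* P. Pudlák, *On reducibility and symmetry of disjoint NP pairs*, TCS 295 (2003), §4.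
-/

namespace Literature.Computability.MetaComplexity

open _root_.Computability Complexity

/-! ### Transport of step lists along an injective renaming of the variables -/

section Transport

variable {ν μ : Type*} [DecidableEq ν] [DecidableEq μ]

omit [DecidableEq ν] [DecidableEq μ] in
/-- Renaming the variables of literals along an injective map is injective. [folklore] -/
theorem literal_rename_injective {f : ν → μ} (hf : Function.Injective f) :
    Function.Injective (fun l : Literal ν => ((f l.1, l.2) : Literal μ)) := by
  intro a b h
  simp only [Prod.mk.injEq] at h
  exact Prod.ext (hf h.1) h.2

/-- A derivation step survives an injective renaming of the variables. [folklore] -/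
theorem DerivStep.image {f : ν → μ} (hf : Function.Injective f) {A : Set (Finset (Literal ν))}
    {C : Finset (Literal ν)} (h : DerivStep A C) :
    DerivStep ((Finset.image fun l : Literal ν => ((f l.1, l.2) : Literal μ)) '' A)
      (C.image fun l => (f l.1, l.2)) := by
  have hinj := literal_rename_injective hf
  rcases h with ⟨D, hD, hDC⟩ | ⟨D, hD, E, hE, v, hvD, hvE, h₁, h₂⟩
  · exact .of_mem ⟨D, hD, rfl⟩ (Finset.image_subset_image hDC)
  · refine .of_res ⟨D, hD, rfl⟩ ⟨E, hE, rfl⟩ (v := f v) (Finset.mem_image.2 ⟨(v, true), hvD, rfl⟩)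
      (Finset.mem_image.2 ⟨(v, false), hvE, rfl⟩) ?_ ?_
    · have := Finset.image_subset_image (f := fun l : Literal ν => ((f l.1, l.2) : Literal μ)) h₁
      rwa [Finset.image_erase hinj] at this
    · have := Finset.image_subset_image (f := fun l : Literal ν => ((f l.1, l.2) : Literal μ)) h₂
      rwa [Finset.image_erase hinj] at this

/-- A step list survives an injective renaming of the variables. [folklore] -/
theorem StepList.image {f : ν → μ} (hf : Function.Injective f) {A : Set (Finset (Literal ν))}
    {L : List (Finset (Literal ν))} (h : StepList A L) :
    StepList ((Finset.image fun l : Literal ν => ((f l.1, l.2) : Literal μ)) '' A)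
      (L.map (Finset.image fun l => (f l.1, l.2))) := by
  induction L generalizing A with
  | nil => trivial
  | cons C L ih =>
    refine ⟨h.1.image hf, ?_⟩
    have := ih h.2
    rwa [Set.image_insert_eq] at this

end Transport

namespace RefCNF

/-- The axioms of `toNat φ` are the renamed axioms of `φ`. [folklore] -/
theorem clauseSet_toNat (φ : CNF RefVar) :
    clauseSet (toNat φ) =
      (Finset.image fun l : Literal RefVar => ((l.1.code, l.2) : Literal ℕ)) '' clauseSet φ := by
  have key : ∀ c : Clause RefVar, (c.map fun l => ((l.1.code, l.2) : Literal ℕ)).toFinset =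
      c.toFinset.image fun l => (l.1.code, l.2) := by
    intro c; ext x; simp
  ext C
  simp only [mem_clauseSet_iff, toNat, Set.mem_image, List.mem_map]
  constructor
  · rintro ⟨c, ⟨c₀, hc₀, rfl⟩, rfl⟩
    exact ⟨c₀.toFinset, ⟨c₀, hc₀, rfl⟩, (key c₀).symm⟩
  · rintro ⟨D, ⟨c₀, hc₀, rfl⟩, rfl⟩
    exact ⟨_, ⟨c₀, hc₀, rfl⟩, key c₀⟩

namespace Pudlak

variable {X : List ℕ} {F : CNF ℕ} {α : ℕ → Bool}

/-- **Pudlák's refutation is a correct derivation**: the list `refutation α n m t` is a step list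
over the axioms of `RREF(F, t+1)` (it ends with the empty clause).
[cite: AtseriasMuller2020, Lemma 11 (proof: True(u) for u = 1, …, s in order, then the empty
clause)] -/
theorem stepList_refutation
    (hT : ∀ j, ∀ hj : j < F.length, ∃ l ∈ F[j], X.idxOf l.1 < X.length ∧ α (X.idxOf l.1) = l.2)
    (t : ℕ) : StepList (clauseSet (rref X F (t + 1))) (refutation α X.length F.length t) := by
  unfold refutation
  refine StepList.append (stepList_flatMap_range fun u hu => ?_) ?_
  · exact stepList_lineBlock Set.subset_union_left hT hu
      fun v hv => Or.inr ⟨v, hv, trueCl_mem_lineBlock α _ _ _ v⟩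
  · refine stepList_lastBlock Set.subset_union_left rfl (Or.inr ?_)
    exact List.mem_flatMap.2 ⟨t, List.mem_range.2 (Nat.lt_succ_self t), trueCl_mem_lineBlock α _ _ _ t⟩

/-- Monomials of degree at most two in each of `s, n, m ≥ 1` are at most `(snm)²`. [folklore] -/
theorem monomial_le_sq {s n m : ℕ} (hs : 1 ≤ s) (hn : 1 ≤ n) (hm : 1 ≤ m) {a b c : ℕ} (ha : a ≤ 2)
    (hb : b ≤ 2) (hc : c ≤ 2) : s ^ a * n ^ b * m ^ c ≤ (s * n * m) ^ 2 := by
  calc s ^ a * n ^ b * m ^ c ≤ s ^ 2 * n ^ 2 * m ^ 2 :=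
        Nat.mul_le_mul (Nat.mul_le_mul (Nat.pow_le_pow_right hs ha) (Nat.pow_le_pow_right hn hb))
          (Nat.pow_le_pow_right hm hc)
    _ = (s * n * m) ^ 2 := by ring

/-- **Length of Pudlák's refutation**: at most `17 · (snm)²` clauses for `s = t + 1` lines and
`n, m ≥ 1`. [cite: AtseriasMuller2020, Lemma 11 ("In fact, p(s,n,m) ∈ O((snm)²)")] -/
theorem length_refutation_le (α : ℕ → Bool) {n m : ℕ} (hn : 1 ≤ n) (hm : 1 ≤ m) (t : ℕ) :
    (refutation α n m t).length ≤ 17 * ((t + 1) * n * m) ^ 2 := by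
  obtain ⟨s, hs_def⟩ : ∃ s, s = t + 1 := ⟨_, rfl⟩
  have hs : 1 ≤ s := by omega
  rw [← hs_def]
  have hblock : ∀ u ∈ List.range s,
      (lineBlock α n m s u).length ≤ 2 * m + n * (s * (n + 3) + (s + 2)) + (n + 4) := by
    intro u hu
    rw [List.mem_range] at hu
    rw [length_lineBlock]
    gcongr
  have hflat : ((List.range s).flatMap (lineBlock α n m s)).length ≤
      s * (2 * m + n * (s * (n + 3) + (s + 2)) + (n + 4)) := by
    rw [List.length_flatMap]
    have := List.sum_le_card_nsmul ((List.range s).map fun u => (lineBlock α n m s u).length)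
      (2 * m + n * (s * (n + 3) + (s + 2)) + (n + 4)) (by
        intro x hx
        obtain ⟨u, hu, rfl⟩ := List.mem_map.1 hx
        exact hblock u hu)
    simpa using this
  have htot : (refutation α n m t).length ≤
      s * (2 * m + n * (s * (n + 3) + (s + 2)) + (n + 4)) + (n + 2) := by
    unfold refutation
    rw [List.length_append, length_lastBlock, ← hs_def]
    exact Nat.add_le_add_right hflat _
  have h1 : s * m ≤ (s * n * m) ^ 2 := by
    simpa using monomial_le_sq hs hn hm (a := 1) (b := 0) (c := 1) (by norm_num) (by norm_num)
      (by norm_num)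
  have h2 : s ^ 2 * n ^ 2 ≤ (s * n * m) ^ 2 := by
    simpa using monomial_le_sq hs hn hm (a := 2) (b := 2) (c := 0) le_rfl le_rfl (by norm_num)
  have h3 : s ^ 2 * n ≤ (s * n * m) ^ 2 := by
    simpa using monomial_le_sq hs hn hm (a := 2) (b := 1) (c := 0) le_rfl (by norm_num)
      (by norm_num)
  have h4 : s * n ≤ (s * n * m) ^ 2 := by
    simpa using monomial_le_sq hs hn hm (a := 1) (b := 1) (c := 0) (by norm_num) (by norm_num)
      (by norm_num)
  have h5 : s ≤ (s * n * m) ^ 2 := by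
    simpa using monomial_le_sq hs hn hm (a := 1) (b := 0) (c := 0) (by norm_num) (by norm_num)
      (by norm_num)
  have h6 : n ≤ (s * n * m) ^ 2 := by
    simpa using monomial_le_sq hs hn hm (a := 0) (b := 1) (c := 0) (by norm_num) (by norm_num)
      (by norm_num)
  have h7 : 1 ≤ (s * n * m) ^ 2 := by
    simpa using monomial_le_sq hs hn hm (a := 0) (b := 0) (c := 0) (by norm_num) (by norm_num)
      (by norm_num)
  have hexp : s * (2 * m + n * (s * (n + 3) + (s + 2)) + (n + 4)) + (n + 2) =
      2 * (s * m) + s ^ 2 * n ^ 2 + 4 * (s ^ 2 * n) + 3 * (s * n) + 4 * s + n + 2 * 1 := by ring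
  calc (refutation α n m t).length
      ≤ s * (2 * m + n * (s * (n + 3) + (s + 2)) + (n + 4)) + (n + 2) := htot
    _ = 2 * (s * m) + s ^ 2 * n ^ 2 + 4 * (s ^ 2 * n) + 3 * (s * n) + 4 * s + n + 2 * 1 := hexp
    _ ≤ 2 * (s * n * m) ^ 2 + (s * n * m) ^ 2 + 4 * (s * n * m) ^ 2 + 3 * (s * n * m) ^ 2 +
          4 * (s * n * m) ^ 2 + (s * n * m) ^ 2 + 2 * (s * n * m) ^ 2 := by gcongr
    _ = 17 * (s * n * m) ^ 2 := by ring

/-- The satisfying assignment, read through the sorted variable list `X = sortedVars F`, gives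
every clause of `F` a literal `l` with `α (X.idxOf l.1) = l.2` where `α i := σ (X[i])`.
[cite: AtseriasMuller2020, proof of Lemma 11 ("Since α satisfies F we can choose for every
j ∈ [m] some i_j ∈ [n] such that X_{i_j}^{(α(X_{i_j}))} appears in C_j")] -/
theorem exists_true_literal {F : CNF ℕ} {σ : ℕ → Bool} (hσ : F.eval σ = true) (j : ℕ)
    (hj : j < F.length) :
    ∃ l ∈ F[j], (sortedVars F).idxOf l.1 < (sortedVars F).length ∧
      σ ((sortedVars F).getD ((sortedVars F).idxOf l.1) 0) = l.2 := by
  have hc : Clause.eval σ F[j] = true := (CNF.eval_eq_true_iff F σ).1 hσ _ (List.getElem_mem hj)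
  obtain ⟨l, hl, hlt⟩ := List.any_eq_true.1 hc
  have hmem : l.1 ∈ sortedVars F := by
    rw [mem_sortedVars, CNF.vars, List.mem_toFinset]
    exact List.mem_map.2 ⟨l, List.mem_flatten.2 ⟨F[j], List.getElem_mem hj, hl⟩, rfl⟩
  have hidx : (sortedVars F).idxOf l.1 < (sortedVars F).length := List.idxOf_lt_length_iff.2 hmem
  refine ⟨l, hl, hidx, ?_⟩
  have hget : (sortedVars F).getD ((sortedVars F).idxOf l.1) 0 = l.1 := by
    rw [List.getD_eq_getElem?_getD, List.getElem?_eq_getElem hidx]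
    simp
  rw [hget]
  simpa [Literal.eval] using hlt

/-- **The upper bound for `RREF(F,s)`** [AM20, Lemma 11] in our Resolution system: for a
satisfiable `F` with `n ≥ 1` variables, `m ≥ 1` clauses, and `s = t + 1` lines,
`minResRefutationSize (rrefCNF F s) ≤ 68 · (snm)²` (Pudlák's refutation realized with at most
four lines per step). [cite: AtseriasMuller2020, Lemma 11] -/
theorem minResRefutationSize_rrefCNF_le (F : CNF ℕ) (t : ℕ) (hn : 1 ≤ (CNF.vars F).card)
    (hm : 1 ≤ F.length) (hsat : F.Satisfiable) :
    minResRefutationSize (rrefCNF F (t + 1)) ≤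
      ((68 * ((t + 1) * (CNF.vars F).card * F.length) ^ 2 : ℕ) : ℕ∞) := by
  obtain ⟨σ, hσ⟩ := hsat
  have hstep := (stepList_refutation (X := sortedVars F) (F := F)
    (α := fun i => σ ((sortedVars F).getD i 0)) (exists_true_literal hσ) t).image
      RefVar.code_injective
  rw [← clauseSet_toNat, ← rrefCNF_eq] at hstep
  have hempty : (∅ : Finset (Literal ℕ)) ∈ (refutation (fun i => σ ((sortedVars F).getD i 0))
      (sortedVars F).length F.length t).map
        (Finset.image fun l : Literal RefVar => ((l.1.code, l.2) : Literal ℕ)) :=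
    List.mem_map.2 ⟨∅, empty_mem_refutation _ _ _ _, by simp⟩
  have hlen := length_refutation_le (fun i => σ ((sortedVars F).getD i 0))
    (n := (sortedVars F).length) (m := F.length) (by rwa [length_sortedVars]) hm t
  have hlen' : 4 * ((refutation (fun i => σ ((sortedVars F).getD i 0)) (sortedVars F).length
      F.length t).map (Finset.image fun l : Literal RefVar => ((l.1.code, l.2) : Literal ℕ))).length
        ≤ 68 * ((t + 1) * (CNF.vars F).card * F.length) ^ 2 := by
    rw [List.length_map, ← length_sortedVars]
    omega
  exact (StepList.minResRefutationSize_le hstep hempty).trans (by exact_mod_cast hlen')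

end Pudlak

end RefCNF

/-! ### Discharge of `rrefCNF_upperBound`, and [AM20, Thm 2] conditional on Lemma 10 alone -/

/-- **Discharge of `rrefCNF_upperBound`** [Atserias–Müller 2020, Lemma 11]: for all `s, n, m ≥ 1`
and every satisfiable CNF `F` with `n` variables and `m` clauses, `RREF(F,s)` has a Resolution
refutation of length `≤ 68 · (snm)²` — Pudlák's refutation (derive `True(u)` for every line `u` in
order, then cut with (A21) and (A24)), formalized as the step list `RefCNF.Pudlak.refutation` of at
most `17 (snm)²` clauses, each realized by at most four lines of our calculus
(`RefCNF.Pudlak.minResRefutationSize_rrefCNF_le`).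
[cite: AtseriasMuller2020, Lemma 11 (arXiv numbering; "p(s,n,m) ∈ O((snm)²)")] -/
theorem rrefCNF_upperBound_holds : rrefCNF_upperBound := by
  refine ⟨68, fun F s hs hn hm hsat => ?_⟩
  obtain ⟨t, rfl⟩ : ∃ t, s = t + 1 := ⟨s - 1, by omega⟩
  exact RefCNF.Pudlak.minResRefutationSize_rrefCNF_le F t hn hm hsat

/-- **Theorem 2 of [AM20] conditional on its Lemma 10 only**: with the upper bound discharged,
the hardness statement `rrefGadget_hardness` follows from the lower bound `rrefCNF_lowerBound`
alone. [cite: AtseriasMuller2020, Thm 2 (a)+(b) and §6] -/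
theorem rrefGadget_hardness_of_lowerBound (hL : rrefCNF_lowerBound) : rrefGadget_hardness :=
  rrefGadget_hardness_of_bounds rrefCNF_upperBound_holds hL

end Literature.Computability.MetaComplexity
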